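import Summits.Ventures.CertifiedManyBodySolver.Observables.PairLROTowerStationaryReading
import HarnessLib

/-!
# OP1-S, registry consumer at `t′ = 0` in the `hubbardTorus 2 L 1 8` vocabulary of the `tp0` claim nodes

HONEST FRAMING: first certified bounds on pairing observables; not a superconductivity verdict; a ceiling
route, never presence. Crew hubbard-obs (D-0042), seat hubbard-obs-p1 (`prover-hubbard-obs-p1-g6-0`).
Zero compute; no definition; no named fact; no `sorry`.

`M3ObsPairLROCeilingAt_of_onePoint_stationary_orbitState_bound_sq` (PairLROTowerStationaryReading) is `t′`-generic
(`H = hubbardTorusTT' L 1 tp 8`, leaf `M3ObsPairLROCeilingAt tp c'`). The `t′ = 0` claim nodes of the registry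
(`Certificates/…obsOP1E…_tp0_…`) are written with `hubbardTorus 2 L 1 8` and read into `M3ObsPairLROCeilingAt_tp0 c'`
(`M3ObsPairLROCeilingAt_tp0_of_onePoint_orbitState_bound_sq`, PairLROTowerCeilingCert). This file is the same
one-application consumer for an OP1-S node at `t′ = 0`:
* **`M3ObsPairLROCeilingAt_tp0_of_onePoint_stationary_orbitState_bound_sq`** — OP1-E `tp0` node shape + the
  equation-of-motion term `Re ω̄_ζ(H_L Γ_L X − Γ_L X H_L)`, `H_L = hubbardTorus 2 L 1 8`, `X ∈ 𝔄_{Λ'}` with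
  `[N̂_{Λ'}, X] = 0` ⇒ `M3ObsPairLROCeilingAt_tp0 c'` for every rational `c' ≥ (c − A + (Σ_σ μ_σ)(7/16 − ν))²`.

References: T. Koma, H. Tasaki, J. Stat. Phys. 76 (1994) 745, Theorem 5 [KomaTasaki1994]; X. Han,
arXiv:2006.06002, §2–3 [Han2020Bootstrap].
-/

noncomputable section

namespace Summit.Ventures.CertifiedManyBodySolver.Observables

open Matrix Complex Finset Literature.MathematicalPhysics.QuantumLattice Literature.Probability.LatticeModels
open Literature.MathematicalPhysics.QuantumLattice.HubbardWave0 ThermodynamicLimit Filter Topology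
open Literature.MathematicalPhysics.QuantumManyBody.StateRelaxation
open Summit.Ventures.CertifiedManyBodySolver.Transport
open scoped ComplexOrder ComplexConjugate BigOperators

/-- **OP1-S registry consumer at `t′ = 0` (`hubbardTorus 2 L 1 8` vocabulary), SHARP constant.** As
`M3ObsPairLROCeilingAt_tp0_of_onePoint_orbitState_bound_sq` plus the number-conserving eom word `X ∈ 𝔄_{Λ'}` and its
term `Re ω̄_ζ(H_L Γ_L X − Γ_L X H_L)` on the left of the claimed inequality; conclusion `M3ObsPairLROCeilingAt_tp0 c'` at
every rational `c' ≥ (c − A + (Σ_σ μ_σ)(7/16 − ν))²`. CONDITIONAL ON THE CLAIM NODE fed in.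
[cite: KomaTasaki1994, Theorem 5] [cite: Han2020Bootstrap, §2–3] -/
theorem M3ObsPairLROCeilingAt_tp0_of_onePoint_stationary_orbitState_bound_sq {hi c' : ℚ} {c A κ u ν : ℝ}
    (μ : Fin 2 → ℝ) (hκ : 0 ≤ κ) (hE : M3EnergyUpperRow 0 hi) (hhi : ((hi : ℚ) : ℝ) ≤ u)
    {S : Finset (DihedralGroup 4)} (hS : S.Nonempty) (hS1 : ∀ γ ∈ S, b1gSign γ = 1)
    {Λ' : Finset (Site 2)} (h0 : pairRegion (insert (0 : Site 2) unitSteps) 0 ⊆ Λ')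
    (X : FermionOp Λ') (hXN : Commute totalNumberOp X) (L₁ : ℕ)
    (hInj : ∀ L : ℕ, L₁ ≤ L → Set.InjOn (Torus.proj (d := 2) L) ↑Λ')
    (hbound : ∀ (L : ℕ) [NeZero L] (hL : L₁ ≤ L) (ζ : Fock (Orb (FermionTorus 2 L))), star ζ ⬝ᵥ ζ = 1 →
      c - A + ∑ σ : Fin 2, μ σ *
          ((star ζ ⬝ᵥ ((∑ y : FermionTorus 2 L, numberOp y σ) *ᵥ ζ)).re / (L : ℝ) ^ 2 - ν) +
        κ * (u - (star ζ ⬝ᵥ (hubbardTorus 2 L 1 8 *ᵥ ζ)).re / (L : ℝ) ^ 2) +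
        (orbitState (spaceGroupUnitary S) ζ
          (hubbardTorus 2 L 1 8 * fermionEmbed (PolySite.toTorusEmb L (hInj L hL)) X -
            fermionEmbed (PolySite.toTorusEmb L (hInj L hL)) X * hubbardTorus 2 L 1 8)).re ≤
        (orbitState (spaceGroupUnitary S) ζ (fermionEmbed (PolySite.toTorusEmb L (hInj L hL))
          (-(fermionEmbed (PolySite.incl h0)
            (localPairAt (insert (0 : Site 2) unitSteps) dWaveFormFactor 0))))).re)
    (hc' : (c - A + (∑ σ : Fin 2, μ σ) * ((7 / 8 : ℝ) / 2 - ν)) ^ 2 ≤ ((c' : ℚ) : ℝ)) :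
    M3ObsPairLROCeilingAt_tp0 c' := by
  rw [← M3ObsPairLROCeilingAt_zero_iff]
  refine M3ObsPairLROCeilingAt_of_onePoint_stationary_orbitState_bound_sq μ hκ hE hhi hS hS1 h0 X hXN L₁ hInj
    ?_ hc'
  intro L _ hL ζ hζ
  rw [hubbardTorusTT'_zero]
  exact hbound L hL ζ hζ

end Summit.Ventures.CertifiedManyBodySolver.Observables

end
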